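import Summits.NavierStokesRegularity.FluidComputer.PalasekTowerGermHostFarFieldBound
import Summits.NavierStokesRegularity.FluidComputer.PalasekTowerGermHostTolerant
import Summits.NavierStokesRegularity.FluidComputer.PalasekTowerGermHostDesign
import Literature.Analysis.FluidPDE.LoopCirculation

/-!
# The germ host, XIX: FAR COMPANIONS — the companion rule for the three design slots

Cell `ns-blowup`, seat `ns-blowup-ecbridge-3` (g4); GROUP C «BRIDGE SUPPORT» of the route
`PalasekTowerBreakdown` (crux `EpisodeBaseG`, item stmt-NavierStokesRegularity-19179, R2 of record;
registered line `Cruxes/EpisodeBase/Lines/slot.lean`, whose one stub quantifies over the STRICT slot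
`Germ.LevelZeroData`). Sequel of `PalasekTowerGermHostFarFieldBound` (XVIII). LABEL: E–C typing
(KERNEL bookkeeping: slot-transfer theorems, no definition). WHAT THIS IS NOT: not Navier–Stokes
evidence — level-`0` bookkeeping of a PRESCRIBED composite profile at one instant and the prescribed
host it inherits; nothing about any flow after `τ₀`, `FirstEpisodeD`, `RungG 1` or blow-up.

## What and why

The slots of record (`LevelZeroData` ⊂ `LevelZeroDataWeak` ⊂ `LevelZeroDataTol c₄`; GermHost III,
ecbridge-4's GermHostPushed, GermHost XV) certify host preparation for ONE profile. A composite design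
`U₁ + U₂` — a certified CARRIER `U₁` (readouts + anchor test, `tsupport U₁ ⊆ B̄(0, ρ₁)`) plus a
COMPANION `U₂` supported outside `B̄(0, ρ₁ + d)`, `d ≥ 1/N₀` (a ring, a dipole, a jet: the would-be
amplifier of the episode) — keeps the carrier's value, Jacobian, speed maximum and core loop (§1, all
local), and its anchor value at every argmax point drops by at most `(3/(2πd⁴)) ‖U₁ x₀‖ ∫‖U₂‖²`
(`anchor_add_far_ge`, from XVIII's far-field bound and GermHost VI's `accel_add_of_notMem`). Hence
§2, **THE COMPANION RULE**, one theorem per slot: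

* `LevelZeroDataTol.add_far`: a tolerant filler at push `c'` plus ANY smooth divergence-free companion
  of speed `< Y₀` with ENERGY BUDGET `(3/(2πd⁴)) ∫‖U₂‖² ≤ (c₄ − c') Y₀ / 8` is a tolerant filler at
  push `c₄`;
* `LevelZeroDataWeak.add_far`: a weak filler plus a companion with `(3/(2πd⁴)) ∫‖U₂‖² < c₄ Y₀ / 8`
  is a tolerant filler at push `c₄`;
* `LevelZeroData.add_far`: a STRICT filler whose anchor values are `≥ m` on its argmax (e.g.
  `m = rate`, GermHost V) plus a companion with `(3/(2πd⁴)) Y₀ ∫‖U₂‖² < m` is STRICT again — the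
  registered stub's `∃ U` therefore ranges over carriers WITH amplifiers;

and by name `LevelZeroDataTol.hostPreparationD_host_add_far` (the composite has a prepared host in
its singleton class `S⋆(U₁ + U₂, c₄)` of XV) and `…episodeBaseG_of_firstEpisodeD_add_far`. The price
of a companion is an energy × `d⁻⁴` budget and nothing else (no symmetry, no sign, no cone).

References: S. Palasek, arXiv:2605.13827 §3.3 (host preparation before the first readout)
[cite: Palasek2026ElementaryModel, §3.3]; A. J. Majda, A. L. Bertozzi, *Vorticity and Incompressible
Flow* (CUP 2002), §1.8 Prop. 1.16 [cite: MajdaBertozziCUP2002, §1.8 Prop. 1.16]; D. Gilbarg,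
N. S. Trudinger, *Elliptic PDE of Second Order* (2001), Lemma 4.1 [cite: GilbargTrudinger2001, Lemma 4.1].
-/

noncomputable section

namespace Summit.NavierStokesRegularity.FluidComputer.PalasekTowerClayBridge.Germ

open Set Function Filter Topology InnerProductSpace Metric MeasureTheory Real
open scoped Topology ContDiff RealInnerProductSpace

open Literature.Analysis.FluidPDE

/-! ## §1 Composite profiles with a far companion -/


section Companion

variable {U₁ U₂ : EuclideanSpace ℝ (Fin 3) → EuclideanSpace ℝ (Fin 3)} {ρ₁ d : ℝ}

/-- A point of norm `≤ ρ₁ + d` is off the support of a companion living outside `B̄(0, ρ₁ + d)`.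
[folklore] -/
theorem notMem_tsupport_of_norm_le (hfar : ∀ y ∈ tsupport U₂, ρ₁ + d < ‖y‖)
    {x : EuclideanSpace ℝ (Fin 3)} (hx : ‖x‖ ≤ ρ₁ + d) : x ∉ tsupport U₂ := fun h => by
  have := hfar x h
  linarith

/-- The carrier's support is off the companion's support. [folklore] -/
theorem notMem_tsupport_of_mem (h₁supp : tsupport U₁ ⊆ closedBall 0 ρ₁)
    (hfar : ∀ y ∈ tsupport U₂, ρ₁ + d < ‖y‖) (hd : 0 < d) {x : EuclideanSpace ℝ (Fin 3)}
    (hx : x ∈ tsupport U₁) : x ∉ tsupport U₂ :=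
  notMem_tsupport_of_norm_le hfar ((mem_closedBall_zero_iff.1 (h₁supp hx)).trans (by linarith))

/-- The two supports are disjoint. [folklore] -/
theorem disjoint_tsupport_of_far (h₁supp : tsupport U₁ ⊆ closedBall 0 ρ₁)
    (hfar : ∀ y ∈ tsupport U₂, ρ₁ + d < ‖y‖) (hd : 0 < d) :
    Disjoint (tsupport U₁) (tsupport U₂) :=
  Set.disjoint_left.2 fun _ hx => notMem_tsupport_of_mem h₁supp hfar hd hx

/-- Every point of `B̄(0, ρ₁)` is at distance `≥ d` from the companion's support. [folklore] -/
theorem le_norm_sub_of_far (hfar : ∀ y ∈ tsupport U₂, ρ₁ + d < ‖y‖) {x : EuclideanSpace ℝ (Fin 3)}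
    (hx : ‖x‖ ≤ ρ₁) : ∀ y ∈ tsupport U₂, d ≤ ‖x - y‖ := fun y hy => by
  have h1 := hfar y hy
  have h2 : ‖y‖ - ‖x‖ ≤ ‖x - y‖ := by
    rw [← norm_neg (x - y), neg_sub]
    exact norm_sub_norm_le y x
  linarith

/-- On the carrier's support the composite IS the carrier. [folklore] -/
theorem add_apply_of_mem (h₁supp : tsupport U₁ ⊆ closedBall 0 ρ₁)
    (hfar : ∀ y ∈ tsupport U₂, ρ₁ + d < ‖y‖) (hd : 0 < d) {x : EuclideanSpace ℝ (Fin 3)}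
    (hx : x ∈ tsupport U₁) : (U₁ + U₂) x = U₁ x := by
  rw [Pi.add_apply, image_eq_zero_of_notMem_tsupport (notMem_tsupport_of_mem h₁supp hfar hd hx),
    add_zero]

/-- Off the carrier's support the composite IS the companion. [folklore] -/
theorem add_apply_of_notMem {x : EuclideanSpace ℝ (Fin 3)} (hx : x ∉ tsupport U₁) :
    (U₁ + U₂) x = U₂ x := by
  rw [Pi.add_apply, image_eq_zero_of_notMem_tsupport hx, zero_add]

/-- The speed of the composite is pointwise the speed of one of the two. [folklore] -/
theorem norm_add_le_max (h₁supp : tsupport U₁ ⊆ closedBall 0 ρ₁)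
    (hfar : ∀ y ∈ tsupport U₂, ρ₁ + d < ‖y‖) (hd : 0 < d) (x : EuclideanSpace ℝ (Fin 3)) :
    ‖(U₁ + U₂) x‖ ≤ max ‖U₁ x‖ ‖U₂ x‖ := by
  by_cases hx : x ∈ tsupport U₁
  · rw [add_apply_of_mem h₁supp hfar hd hx]; exact le_max_left _ _
  · rw [add_apply_of_notMem hx]; exact le_max_right _ _

/-- **Argmax**: if the companion is everywhere slower than `Y`, a point where the composite has speed
`Y` lies on the carrier's support and is a speed-`Y` point of the carrier. [folklore] -/
theorem mem_tsupport_of_norm_add_eq (h₁supp : tsupport U₁ ⊆ closedBall 0 ρ₁)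
    (hfar : ∀ y ∈ tsupport U₂, ρ₁ + d < ‖y‖) (hd : 0 < d) {Y : ℝ} (h₂lt : ∀ x, ‖U₂ x‖ < Y)
    {x : EuclideanSpace ℝ (Fin 3)} (hx : ‖(U₁ + U₂) x‖ = Y) : x ∈ tsupport U₁ ∧ ‖U₁ x‖ = Y := by
  by_cases hx1 : x ∈ tsupport U₁
  · exact ⟨hx1, by rwa [add_apply_of_mem h₁supp hfar hd hx1] at hx⟩
  · exfalso
    rw [add_apply_of_notMem hx1] at hx
    exact absurd hx (h₂lt x).ne

/-- On the carrier's support the composite's Jacobian IS the carrier's. [folklore] -/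
theorem fderiv_add_of_mem (h₁s : ContDiff ℝ ∞ U₁) (h₁supp : tsupport U₁ ⊆ closedBall 0 ρ₁)
    (h₂s : ContDiff ℝ ∞ U₂) (hfar : ∀ y ∈ tsupport U₂, ρ₁ + d < ‖y‖) (hd : 0 < d)
    {x : EuclideanSpace ℝ (Fin 3)} (hx : x ∈ tsupport U₁) :
    fderiv ℝ (U₁ + U₂) x = fderiv ℝ U₁ x := by
  rw [fderiv_add ((h₁s.differentiable (by simp)) x) ((h₂s.differentiable (by simp)) x),
    fderiv_eq_zero_of_notMem_tsupport (notMem_tsupport_of_mem h₁supp hfar hd hx), add_zero]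

/-- The composite is divergence free if both parts are (the divergence is the trace of the Jacobian,
additive). [folklore] -/
theorem isDivFree_add (h₁s : ContDiff ℝ ∞ U₁) (h₂s : ContDiff ℝ ∞ U₂)
    (hdiv₁ : VectorCalculus.IsDivFree U₁) (hdiv₂ : VectorCalculus.IsDivFree U₂) :
    VectorCalculus.IsDivFree (U₁ + U₂) := by
  intro x
  have e₁ := hdiv₁ x
  have e₂ := hdiv₂ x
  simp only [VectorCalculus.divergence] at e₁ e₂ ⊢
  rw [fderiv_add ((h₁s.differentiable (by simp)) x) ((h₂s.differentiable (by simp)) x)]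
  push_cast
  rw [map_add, e₁, e₂, add_zero]

/-- **Core loops transfer**: a loop staying in `B̄(x, 1/N₀)` with `‖x‖ ≤ ρ₁` and `1/N₀ ≤ d` never meets
the companion, so its circulation in the composite is its circulation in the carrier. [folklore] -/
theorem circulation_add_of_loop (h₁s : ContDiff ℝ ∞ U₁) (h₂s : ContDiff ℝ ∞ U₂)
    (hfar : ∀ y ∈ tsupport U₂, ρ₁ + d < ‖y‖) (hdN : 1 / TowerRates.wide.N 0 ≤ d)
    {x : EuclideanSpace ℝ (Fin 3)} (hx : ‖x‖ ≤ ρ₁) {γ : ℝ → EuclideanSpace ℝ (Fin 3)}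
    (hγ : ContDiff ℝ 1 γ) (hball : ∀ s ∈ Icc (0 : ℝ) 1, γ s ∈ closedBall x (1 / TowerRates.wide.N 0)) :
    circulation (U₁ + U₂) γ = circulation U₁ γ := by
  rw [circulation_add_left h₁s.continuous h₂s.continuous hγ, add_eq_left]
  unfold circulation
  rw [intervalIntegral.integral_congr (g := fun _ => (0 : ℝ)) fun s hs => ?_]
  · simp
  · have hs' : s ∈ Icc (0 : ℝ) 1 := by rwa [uIcc_of_le zero_le_one] at hs
    have hγs : ‖γ s‖ ≤ ρ₁ + d := by
      have h1 : ‖γ s - x‖ ≤ 1 / TowerRates.wide.N 0 := mem_closedBall_iff_norm.1 (hball s hs')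
      have h2 : ‖γ s‖ ≤ ‖γ s - x‖ + ‖x‖ := norm_le_norm_sub_add _ _
      linarith
    have h0 : U₂ (γ s) = 0 := image_eq_zero_of_notMem_tsupport (notMem_tsupport_of_norm_le hfar hγs)
    simp [h0]

/-- **THE ANCHOR VALUE OF THE COMPOSITE AT A CARRIER POINT** (GermHost VI + XVIII): for a
divergence-free far companion `U₂ ∈ C_c^∞` and `x₀ ∈ tsupport U₁`,
`⟪(U₁+U₂)(x₀), V[U₁+U₂](x₀)⟫ ≥ ⟪U₁(x₀), V[U₁](x₀)⟫ − (3/(2πd⁴)) ‖U₁(x₀)‖ ∫‖U₂‖²`.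
[cite: MajdaBertozziCUP2002, §1.8 Prop. 1.16] -/
theorem anchor_add_far_ge (h₁s : ContDiff ℝ ∞ U₁) (h₁supp : tsupport U₁ ⊆ closedBall 0 ρ₁)
    (h₂s : ContDiff ℝ ∞ U₂) (h₂c : HasCompactSupport U₂) (hdiv₂ : VectorCalculus.IsDivFree U₂)
    (hfar : ∀ y ∈ tsupport U₂, ρ₁ + d < ‖y‖) (hd : 0 < d) {x₀ : EuclideanSpace ℝ (Fin 3)}
    (hx₀ : x₀ ∈ tsupport U₁) :
    ⟪U₁ x₀, accel 1 U₁ x₀⟫ - 3 / (2 * π * d ^ 4) * ‖U₁ x₀‖ * ∫ x, ‖U₂ x‖ ^ 2 ≤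
      ⟪(U₁ + U₂) x₀, accel 1 (U₁ + U₂) x₀⟫ := by
  have h₁c : HasCompactSupport U₁ :=
    (isCompact_closedBall (0 : EuclideanSpace ℝ (Fin 3)) ρ₁).of_isClosed_subset (isClosed_tsupport U₁)
      h₁supp
  have hx2 : x₀ ∉ tsupport U₂ := notMem_tsupport_of_mem h₁supp hfar hd hx₀
  rw [accel_add_of_notMem h₁s h₁c h₂s h₂c (disjoint_tsupport_of_far h₁supp hfar hd) hx2,
    add_apply_of_mem h₁supp hfar hd hx₀, inner_sub_right]
  have hb := abs_inner_gradient_pot_le_of_far (ν := 1) h₂s h₂c hdiv₂ hd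
    (le_norm_sub_of_far hfar (mem_closedBall_zero_iff.1 (h₁supp hx₀))) (U₁ x₀)
  rw [real_inner_comm] at hb
  have := (abs_le.1 hb).2
  linarith

end Companion

/-! ## §2 The companion rule for the three slots -/

section Slots

variable {U₁ U₂ : EuclideanSpace ℝ (Fin 3) → EuclideanSpace ℝ (Fin 3)} {ρ₁ ρ d : ℝ}
  (h₂s : ContDiff ℝ ∞ U₂) (hdiv₂ : VectorCalculus.IsDivFree U₂)
  (h₂supp : tsupport U₂ ⊆ closedBall 0 ρ) (hρ : ρ₁ ≤ ρ)
  (hfar : ∀ y ∈ tsupport U₂, ρ₁ + d < ‖y‖) (hdN : 1 / TowerRates.wide.N 0 ≤ d)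
  (h₂lt : ∀ x, ‖U₂ x‖ < TowerRates.wide.Y 0)

include h₂s hdiv₂ h₂supp hρ hfar hdN h₂lt

/-- **THE COMPANION RULE, TOLERANT SLOT.** A tolerant filler `U₁` at push `c'` in `B̄(0, ρ₁)` plus a
smooth divergence-free companion `U₂` supported in `B̄(0, ρ)` outside `B̄(0, ρ₁ + d)` (`d ≥ 1/N₀`),
everywhere slower than `Y₀`, with ENERGY BUDGET `(3/(2πd⁴)) ∫‖U₂‖² ≤ (c₄ − c') Y₀ / 8`, is a tolerant
filler at push `c₄` in `B̄(0, ρ)`. [cite: Palasek2026ElementaryModel, §3.3] -/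
theorem LevelZeroDataTol.add_far {c' c₄ : ℝ} (h₁ : LevelZeroDataTol c' U₁ ρ₁)
    (hbudget : 3 / (2 * π * d ^ 4) * ∫ x, ‖U₂ x‖ ^ 2 ≤ (c₄ - c') * TowerRates.wide.Y 0 / 8) :
    LevelZeroDataTol c₄ (U₁ + U₂) ρ := by
  have hd : 0 < d := lt_of_lt_of_le (by rw [Host.wide_N_zero]; norm_num) hdN
  have h₂c : HasCompactSupport U₂ :=
    (isCompact_closedBall (0 : EuclideanSpace ℝ (Fin 3)) ρ).of_isClosed_subset (isClosed_tsupport U₂)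
      h₂supp
  have hY := Host.wide_Y_zero_pos
  refine ⟨h₁.smooth.add h₂s, ?_, isDivFree_add h₁.smooth h₂s h₁.divFree hdiv₂, ?_, ?_, ?_, ?_, ?_⟩
  · refine (tsupport_add U₁ U₂).trans (union_subset (h₁.support.trans ?_) h₂supp)
    exact closedBall_subset_closedBall hρ
  · intro x
    refine (norm_add_le_max h₁.support hfar hd x).trans (max_le (h₁.ceiling x) (h₂lt x).le)
  · obtain ⟨x, hx, hfl⟩ := h₁.floor
    have hx1 : x ∈ tsupport U₁ := subset_tsupport _ (mem_support.2 fun h0 => by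
      rw [h0, norm_zero] at hfl; linarith)
    exact ⟨x, hx.trans hρ, by rwa [add_apply_of_mem h₁.support hfar hd hx1]⟩
  · obtain ⟨x, hx, hst⟩ := h₁.strain
    have hA : 0 < TowerRates.wide.A 0 := by
      rw [Host.wide_A_zero_eq, Host.wide_N_zero]; positivity
    have hx1 : x ∈ tsupport U₁ := by
      refine tsupport_fderiv_subset ℝ (subset_tsupport _ (mem_support.2 fun h0 => ?_))
      rw [h0, norm_zero] at hst
      linarith
    exact ⟨x, hx.trans hρ, by rwa [fderiv_add_of_mem h₁.smooth h₁.support h₂s hfar hd hx1]⟩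
  · obtain ⟨x, γ, hx, hγ, hcl, hball, hspeed, hcirc⟩ := h₁.core
    exact ⟨x, γ, hx.trans hρ, hγ, hcl, hball, hspeed, by
      rwa [circulation_add_of_loop h₁.smooth h₂s hfar hdN hx hγ hball]⟩
  · intro x hx
    obtain ⟨hx1, hY1⟩ := mem_tsupport_of_norm_add_eq h₁.support hfar hd h₂lt hx
    have ha := h₁.anchor x hY1
    have hge := anchor_add_far_ge h₁.smooth h₁.support h₂s h₂c hdiv₂ hfar hd hx1
    rw [hY1] at hge
    have hb : 3 / (2 * π * d ^ 4) * TowerRates.wide.Y 0 * ∫ x, ‖U₂ x‖ ^ 2 ≤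
        (c₄ - c') * TowerRates.wide.Y 0 ^ 2 / 8 := by
      have := mul_le_mul_of_nonneg_left hbudget hY.le
      linarith [this]
    linarith

/-- **THE COMPANION RULE, WEAK SLOT** (ecbridge-4's `LevelZeroDataWeak`): a weak filler plus a far
companion with `(3/(2πd⁴)) ∫‖U₂‖² < c₄ Y₀ / 8` is a tolerant filler at push `c₄`.
[cite: Palasek2026ElementaryModel, §3.3] -/
theorem LevelZeroDataWeak.add_far {c₄ : ℝ} (h₁ : LevelZeroDataWeak U₁ ρ₁)
    (hbudget : 3 / (2 * π * d ^ 4) * ∫ x, ‖U₂ x‖ ^ 2 < c₄ * TowerRates.wide.Y 0 / 8) :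
    LevelZeroDataTol c₄ (U₁ + U₂) ρ := by
  have hY := Host.wide_Y_zero_pos
  -- room between the budget and `c₄`: the carrier is a tolerant filler at a small push `c' > 0`
  set CI := 3 / (2 * π * d ^ 4) * ∫ x, ‖U₂ x‖ ^ 2 with hCI
  set δ := c₄ * TowerRates.wide.Y 0 / 8 - CI with hδ
  have hδ0 : 0 < δ := by rw [hδ]; linarith
  set c' := 4 * δ / TowerRates.wide.Y 0 with hc'
  have hc'0 : 0 < c' := by positivity
  have he : c' * TowerRates.wide.Y 0 = 4 * δ := by rw [hc']; field_simp
  have hc'b : CI ≤ (c₄ - c') * TowerRates.wide.Y 0 / 8 := by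
    have : (c₄ - c') * TowerRates.wide.Y 0 / 8 = c₄ * TowerRates.wide.Y 0 / 8 - δ / 2 := by
      rw [sub_mul, he]; ring
    rw [this, hδ]
    linarith
  exact (h₁.tol hc'0).add_far h₂s hdiv₂ h₂supp hρ hfar hdN h₂lt hc'b

/-- **THE COMPANION RULE, STRICT SLOT** (the slot of the registered line `Lines/slot.lean`): a strict
filler whose anchor values on its argmax are `≥ m`, plus a far companion with
`(3/(2πd⁴)) Y₀ ∫‖U₂‖² < m`, is a STRICT filler in `B̄(0, ρ)`. (For the minimum `m = rate` of a strict
filler see GermHost V, `LevelZeroData.rate_le`.) [cite: Palasek2026ElementaryModel, §3.3] -/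
theorem LevelZeroData.add_far (h₁ : LevelZeroData U₁ ρ₁) {m : ℝ}
    (hm : ∀ x, ‖U₁ x‖ = TowerRates.wide.Y 0 → m ≤ ⟪U₁ x, accel 1 U₁ x⟫)
    (hbudget : 3 / (2 * π * d ^ 4) * TowerRates.wide.Y 0 * ∫ x, ‖U₂ x‖ ^ 2 < m) :
    LevelZeroData (U₁ + U₂) ρ := by
  have hd : 0 < d := lt_of_lt_of_le (by rw [Host.wide_N_zero]; norm_num) hdN
  have h₂c : HasCompactSupport U₂ :=
    (isCompact_closedBall (0 : EuclideanSpace ℝ (Fin 3)) ρ).of_isClosed_subset (isClosed_tsupport U₂)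
      h₂supp
  have hY := Host.wide_Y_zero_pos
  -- everything except the anchor is the tolerant bookkeeping (carrier at push `1`, composite at a
  -- push `c₄` large enough for the budget)
  set CI := 3 / (2 * π * d ^ 4) * ∫ x, ‖U₂ x‖ ^ 2 with hCI
  set c₄ := 1 + 8 * CI / TowerRates.wide.Y 0 with hc₄
  have he : (c₄ - 1) * TowerRates.wide.Y 0 / 8 = CI := by rw [hc₄]; field_simp; ring
  have ht : LevelZeroDataTol c₄ (U₁ + U₂) ρ :=
    (h₁.tol one_pos).add_far h₂s hdiv₂ h₂supp hρ hfar hdN h₂lt he.ge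
  refine ⟨ht.smooth, ht.support, ht.divFree, ht.ceiling, ht.floor, ht.strain, ht.core, ?_⟩
  intro x hx
  obtain ⟨hx1, hY1⟩ := mem_tsupport_of_norm_add_eq h₁.support hfar hd h₂lt hx
  have ha := hm x hY1
  have hge := anchor_add_far_ge h₁.smooth h₁.support h₂s h₂c hdiv₂ hfar hd hx1
  rw [hY1] at hge
  linarith

/-- **Corollary (strict slot, with the carrier's own rising rate)**: a strict filler plus a far companion
with `(3/(2πd⁴)) Y₀ ∫‖U₂‖² < rate(U₁)` (GermHost V, `LevelZeroData.rate`: the positive minimum of the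
anchor values on the argmax) is a strict filler. [cite: Palasek2026ElementaryModel, §3.3] -/
theorem LevelZeroData.add_far_rate (h₁ : LevelZeroData U₁ ρ₁)
    (hbudget : 3 / (2 * π * d ^ 4) * TowerRates.wide.Y 0 * ∫ x, ‖U₂ x‖ ^ 2 < h₁.rate) :
    LevelZeroData (U₁ + U₂) ρ :=
  h₁.add_far h₂s hdiv₂ h₂supp hρ hfar hdN h₂lt (fun _ hx => h₁.rate_le hx) hbudget

/-- **HOST PREPARATION FOR THE COMPOSITE** (by name, tolerant slot): under the companion rule the
composite `U₁ + U₂` has a prepared host in its singleton class, `S⋆(U₁ + U₂, c₄)` of GermHost XV.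
[cite: Palasek2026ElementaryModel, §3.3] -/
theorem LevelZeroDataTol.hostPreparationD_host_add_far {c' c₄ : ℝ} (h₁ : LevelZeroDataTol c' U₁ ρ₁)
    (hbudget : 3 / (2 * π * d ^ 4) * ∫ x, ‖U₂ x‖ ^ 2 ≤ (c₄ - c') * TowerRates.wide.Y 0 / 8)
    (hc₄ : 0 < c₄) (hc₄' : c₄ ≤ 1) :
    HostPreparationD (HostClass.exact
      ((h₁.add_far h₂s hdiv₂ h₂supp hρ hfar hdN h₂lt hbudget).host hc₄ hc₄')) :=
  (h₁.add_far h₂s hdiv₂ h₂supp hρ hfar hdN h₂lt hbudget).hostPreparationD_host hc₄ hc₄'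

/-- … and the crux for the composite design reduces to its episode: `FirstEpisodeD` over the singleton
class of `S⋆(U₁ + U₂, c₄)` gives `EpisodeBaseG`. [cite: Palasek2026ElementaryModel, §4] -/
theorem LevelZeroDataTol.episodeBaseG_of_firstEpisodeD_add_far {c' c₄ : ℝ}
    (h₁ : LevelZeroDataTol c' U₁ ρ₁)
    (hbudget : 3 / (2 * π * d ^ 4) * ∫ x, ‖U₂ x‖ ^ 2 ≤ (c₄ - c') * TowerRates.wide.Y 0 / 8)
    (hc₄ : 0 < c₄) (hc₄' : c₄ ≤ 1)
    (hF : FirstEpisodeD (HostClass.exact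
      ((h₁.add_far h₂s hdiv₂ h₂supp hρ hfar hdN h₂lt hbudget).host hc₄ hc₄'))) : EpisodeBaseG :=
  (h₁.add_far h₂s hdiv₂ h₂supp hρ hfar hdN h₂lt hbudget).episodeBaseG_of_firstEpisodeD hc₄ hc₄' hF

end Slots

end Summit.NavierStokesRegularity.FluidComputer.PalasekTowerClayBridge.Germ

end
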